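import Summits.NavierStokesRegularity.NavierStokesRegularity.Theorems.ScenarioCensusRowF19peakFloor

/-!
# Census row F19 family, peak members — part 3/4: §6 the integral door at the speed peak (rows I-peak / IG-peak,
# `IntegralPeakFloor`) and the joint row PG-peak

Re-homed for the scenario census (typer seat ns-census-typer-1 g6; lead g8 GO 2026-08-28T18:54Z, OPTIONAL (3) «F19 peak members»:
PORT of ns-idea-3 LINE 13 «peak-push» REV 3, `pub/ideators/ns-idea-3/lines/peak-push/line-peak-push.rev3.lean`, sha16
191fe95c2723e21c, 991 l., §1–§7 — REV 4 = REV 3 + §8 «pressure-force rows», NOT ported now; lean check rc 0, 0 sorry; ref g7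
PRE-CHECK ✓ §12.31; critic idea-crit-3 RE-STAMPs 17:19:45Z / 17:22:09Z; lead g7 BOOKINGS 17:28Z: MEMBERS OF RECORD of the F19
family row = G-peak, IG-peak, F1peak — TREE records under ROW POLICY 15:11Z / cen9 (2), no new row, no value change), split for
the 400-line rule into `ScenarioCensusRowF19peakTop` (§1–§3: speed peaks, criteria, rows, the curved moving level, the
first-crossing lemma) → `ScenarioCensusRowF19peakFloor` (§4–§5: the peak-push floor from row F1a BY NAME, rows P/G/G-lab/F1peak,
residual) → `ScenarioCensusRowF19peakDoor` (§6: the integral door, rows I/IG/PG-peak) → `ScenarioCensusRowF19peak` (§7: the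
lattice on classical solutions; census keys).  Lean text VERBATIM in namespace `…Theorems.ScenarioCensus.PeakPush` (the line's
`…Cruxes.ScenarioCensusRowF1.PeakPushLine` re-homed); the three real-variable tools identical to LINE 11's (`deltaStar_pos`,
`kappa_mul_lt_one`, `hasDerivAt_inv_sqrt_sub`) are taken from the tree's F19 port (`ScenarioCensus.QuasiSteadyTop`,
`ScenarioCensusRowF19Top.lean`) instead of being restated; one bib key corrected (`Tao2013Localisation`); the `[folklore]`
tags of the parameterless row `def`s dropped (gate relocation rule); one-line docstrings added to six undocumented auxiliaries.

This part: rows `Row_Ipeak` / `Row_IGpeak` (a dominating clock `g` with a BOUNDED PRIMITIVE, any size), `IntegralPeakFloor`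
(`integralPeakFloor_of_rowF1a`: `exists_peak_hit_level` + `doorLevel` + F1a with `C = 1`), `rowIpeak_holds`, `rowIGpeak_holds`;
the joint row `Row_PGpeak` with `rowPGpeak_holds`, edges `rowPpeak_of_rowPGpeak`, `rowGpeak_of_rowPGpeak`.

No census value is asserted here (the lead books the F19 family); NS regularity is NOT proved; `Row_F1` stays open
(≡ `TypeIPeakModeration`); no summit statement is proved by this file.
-/

noncomputable section

set_option linter.dupNamespace false

open MeasureTheory Set Function Filter TopologicalSpace Metric
open scoped Topology NNReal ENNReal Laplacian RealInnerProductSpace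

namespace Summit.NavierStokesRegularity.NavierStokesRegularity.Theorems.ScenarioCensus.PeakPush

open Literature.Analysis Literature.Analysis.FluidPDE
open Summit.NavierStokesRegularity.NavierStokesRegularity.Theorems
open Summit.NavierStokesRegularity.FluidComputer.PalasekTowerClayBridge

variable {ν T : ℝ} {u : ℝ → E3 → E3} {p : ℝ → E3 → ℝ}

/-! ## §6 (REV 2) The integral door at the speed peak, and the joint row

Two completions of the speed-peak family.
(a) THE INTEGRAL DOOR.  If near `T` the net pressure push per unit speed at the fast speed peaks is
dominated by ANY clock `g` with a bounded primitive on a final window (`G' = g`, `|G| ≤ B` on `(T₀,T)`) —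
`−⟪u,∇p⟫ ≤ ν|Du|²_F + g(t)|u|` — there is no blow-up (`Row_Ipeak`, PROVED); likewise for the speed gain
`⟪u,∂ₜu⟫ ≤ g(t)|u|` (`Row_IGpeak`, PROVED).  The clock may be arbitrarily LARGE; these rows are
incomparable with P-peak / G-peak (small constant at the non-integrable critical clock `√ν(T−t)^{-3/2}`) —
the speed-peak counterpart of the pair (integral door, subcritical door) of S35 `ArgmaxDoors` for the
vorticity.  Structural form `IntegralPeakFloor` (PROVED, any rate): in every Clay blow-up the peak push per
unit speed, net of dissipation, is dominated by NO clock with a bounded primitive — at the fastest particle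
`∫ (−⟪û,∇p⟫ − ν|Du|²_F/|u|)₊ dt = ∞` in the weak sense — and neither is the peak gain.  Mechanism: the
general first-crossing lemma `exists_peak_hit_level` (§3's lemma for an arbitrary `C¹` level bounded below
by `K > 0`) applied to the DOOR LEVEL `doorLevel A s₁ G t = A + (G(t ∨ s₁) − G(s₁)) + (t ∨ s₁ − s₁)`
(slope `g + 1`, bounded on `[0,T)`), which a blow-up must cross by F1a's contrapositive with `C = 1`.
(b) THE JOINT ROW `Row_PGpeak` (PROVED): no blow-up if at every fast speed peak near `T` the pressure push
OR the speed gain is `δ`-subcritical — the exact contrapositive reading of the peak-push floor; it contains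
both P-peak and G-peak (`rowPpeak_of_rowPGpeak`, `rowGpeak_of_rowPGpeak`). -/

/-- **The general first-crossing lemma**: §3's `exists_peak_hit` for an arbitrary level `L`, continuous on
`[0,t₂]`, bounded below by `K > 0` there, with a one-sided derivative `L'(t)` within `(−∞,t]` at every
`t ∈ (t₁,t₂]`.  At the first crossing `(t⋆,x⋆)`: a speed peak, `|u| = L(t⋆)`, the hitting inequality with
drift `ν|Du|²_F + ⟪u,∇p⟫ + |u| L'(t⋆) ≤ 0` and `|u| L'(t⋆) ≤ ⟪u,∂ₜu⟫`.  Tree ingredients BY NAME as in §3.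
[cite: Tao2013Localisation, Cor. 11.1] [cite: GilbargTrudinger2001, §3.1] -/
theorem exists_peak_hit_level (hν : 0 < ν) (hT : 0 < T)
    (hsol : IsClassicalNSSolutionOn (Ico 0 T) ν 0 u p) (hLH : IsLerayHopfOn T ν 0 (u 0) u)
    (hdec : HasRapidSpatialDecay (u 0)) {L L' : ℝ → ℝ} {K t₁ t₂ : ℝ} (hK : 0 < K)
    (ht₁ : 0 < t₁) (ht₁₂ : t₁ < t₂) (ht₂ : t₂ < T)
    (hLc : ContinuousOn L (Icc 0 t₂)) (hKL : ∀ t ∈ Icc 0 t₂, K ≤ L t)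
    (hLd : ∀ t ∈ Ioc t₁ t₂, HasDerivWithinAt L (L' t) (Iic t) t)
    (hbefore : ∀ t ∈ Icc 0 t₁, ∀ x, ‖u t x‖ < L t)
    (hreach : ∃ x, L t₂ ≤ ‖u t₂ x‖) :
    ∃ t₀ ∈ Ioc t₁ t₂, ∃ x₀ : E3, IsSpeedPeak u t₀ x₀ ∧ ‖u t₀ x₀‖ = L t₀ ∧
      ν * frobeniusNormSq (fderiv ℝ (u t₀) x₀) + ⟪u t₀ x₀, gradient (p t₀) x₀⟫ +
          ‖u t₀ x₀‖ * L' t₀ ≤ 0 ∧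
      ‖u t₀ x₀‖ * L' t₀ ≤ ⟪u t₀ x₀, timeDerivWithin (Ico 0 T) u t₀ x₀⟫ := by
  have ht₂0 : 0 < t₂ := ht₁.trans ht₁₂
  have hsolc : IsClassicalNSSolutionOn (Icc 0 t₂) ν 0 u p :=
    hsol.mono (Icc_subset_Ico_right ht₂) (uniqueDiffOn_Icc ht₂0)
  -- Tao class on the closed sub-slab: uniform bounds and uniform spatial decay below `K ≤ L`
  obtain ⟨q, hsolq, hH, -, -⟩ := RungReynoldsOne.stub_taoCover hν hT hsol hLH hdec ⟨ht₂0, ht₂⟩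
  obtain ⟨M, -, hM⟩ := exists_forall_norm_le_of_hasBoundedSobolevNormsOn hsolq hH
  obtain ⟨B, -, hB⟩ := exists_forall_norm_fderiv_le_of_hasBoundedSobolevNormsOn
    (fun s hs => (hsolc.contDiff_velocity hs).of_le (by norm_cast)) hH
  have hE : ∃ C : ℝ≥0, ∀ t ∈ Icc 0 t₂, ∫⁻ x, ‖u t x‖ₑ ^ 2 ≤ C :=
    ⟨(2 * VectorCalculus.kineticEnergy (u 0)).toNNReal, fun t ht =>
      hLH.lintegral_enorm_sq_le hν.le ⟨ht.1, ht.2.trans ht₂.le⟩⟩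
  obtain ⟨ρ, hρ⟩ := LocalEnergy.exists_radius_norm_lt hν ht₂0 hsolc isSmoothOnHalfSpace_zero
    hasRapidSpaceTimeDecay_zero hM hB hE hK
  have hdecL : ∃ ρ : ℝ, ∀ t ∈ Icc 0 t₂, ∀ x : E3, ρ ≤ ‖x‖ → ‖u t x‖ < L t :=
    ⟨ρ, fun t ht x hx => (hρ t ht x hx).trans_le (hKL t ht)⟩
  -- first hitting of the level
  obtain ⟨t₀, ht₀, x₀, heq, hmax, hpast⟩ :=
    HittingCalculus.exists_firstHitting_movingLevel_of_decay hsolc hLc ⟨ht₁.le, ht₁₂.le⟩ ht₁₂.le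
      le_rfl hbefore hreach hdecL
  have ht₀0 : 0 < t₀ := ht₁.trans ht₀.1
  have hpeak : IsSpeedPeak u t₀ x₀ := fun y => (hmax y).trans heq.ge
  have hL' := hLd t₀ ht₀
  have hpast' : ∀ t ∈ Ico 0 t₀, ‖u t x₀‖ ≤ L t := fun t ht => (hpast t ht x₀).le
  have hhit := HittingCalculus.hitting_inequality_drift hsolc hν.le ⟨ht₀0, ht₀.2⟩
    (fun x => (hmax x).trans heq.ge) hL' hpast' heq
  have hgain := HittingCalculus.inner_timeDeriv_ge_of_past_le hsolc ⟨ht₀0, ht₀.2⟩ hL' hpast' heq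
  have hzero : ⟪u t₀ x₀, (0 : ℝ → E3 → E3) t₀ x₀⟫ = 0 := by simp
  have hconv : timeDerivWithin (Icc 0 t₂) u t₀ x₀ = timeDerivWithin (Ico 0 T) u t₀ x₀ :=
    hsol.smooth_velocity.timeDerivWithin_eq_of_subset (Icc_subset_Ico_right ht₂)
      (uniqueDiffOn_Icc ht₂0) ⟨ht₀0.le, ht₀.2⟩ x₀
  rw [hzero, ← heq] at hhit
  rw [hconv, ← heq] at hgain
  exact ⟨t₀, ht₀, x₀, hpeak, heq, hhit, hgain⟩

/-- **Dominated peak push** (integral-door hypothesis): on a final window `(T₀,T)` some clock `g` with a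
primitive `G`, `|G| ≤ B`, dominates the net pressure push per unit speed at the fast speed peaks:
`−⟪u,∇p⟫ ≤ ν|Du|²_F + g(t)|u|` (e.g. `g ∈ L¹(T₀,T)` continuous, `G = ∫g`; `g` may be large). [folklore] -/
def HasDominatedPeakPush (ν T : ℝ) (u : ℝ → E3 → E3) (p : ℝ → E3 → ℝ) : Prop :=
  ∃ (Λ B T₀ : ℝ) (G g : ℝ → ℝ), T₀ < T ∧ (∀ t ∈ Ioo T₀ T, HasDerivAt G (g t) t) ∧
    (∀ t ∈ Ioo T₀ T, |G t| ≤ B) ∧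
    ∀ᶠ t in 𝓝[<] T, ∀ x, IsSpeedPeak u t x → Λ < ‖u t x‖ →
      -⟪u t x, gradient (p t) x⟫ ≤ ν * frobeniusNormSq (fderiv ℝ (u t) x) + g t * ‖u t x‖

/-- **Dominated peak gain**: `⟪u,∂ₜu⟫ ≤ g(t)|u|` at the fast speed peaks near `T`, for a clock `g` with a
bounded primitive on a final window. [folklore] -/
def HasDominatedPeakGain (T : ℝ) (u : ℝ → E3 → E3) : Prop :=
  ∃ (Λ B T₀ : ℝ) (G g : ℝ → ℝ), T₀ < T ∧ (∀ t ∈ Ioo T₀ T, HasDerivAt G (g t) t) ∧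
    (∀ t ∈ Ioo T₀ T, |G t| ≤ B) ∧
    ∀ᶠ t in 𝓝[<] T, ∀ x, IsSpeedPeak u t x → Λ < ‖u t x‖ →
      ⟪u t x, timeDerivWithin (Ico 0 T) u t x⟫ ≤ g t * ‖u t x‖

/-- **Row I-peak** (the integral door at the speed peak; no rate · no symmetry · Clay class): dominated
peak push ⇒ smooth extension past `T`.  PROVED (`rowIpeak_holds`). -/
def Row_Ipeak : Prop :=
  ∀ (ν T : ℝ), 0 < ν → 0 < T →
    ∀ (u : ℝ → E3 → E3) (p : ℝ → E3 → ℝ),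
    IsClassicalNSSolutionOn (Ico 0 T) ν 0 u p → IsLerayHopfOn T ν 0 (u 0) u →
    HasRapidSpatialDecay (u 0) → HasDominatedPeakPush ν T u p → HasSmoothExtensionPast ν 0 u T

/-- **Row IG-peak**: dominated peak gain ⇒ smooth extension past `T`.  PROVED (`rowIGpeak_holds`). -/
def Row_IGpeak : Prop :=
  ∀ (ν T : ℝ), 0 < ν → 0 < T →
    ∀ (u : ℝ → E3 → E3) (p : ℝ → E3 → ℝ),
    IsClassicalNSSolutionOn (Ico 0 T) ν 0 u p → IsLerayHopfOn T ν 0 (u 0) u →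
    HasRapidSpatialDecay (u 0) → HasDominatedPeakGain T u → HasSmoothExtensionPast ν 0 u T

/-- **Structural statement «the integral peak floor»**: in every Clay blow-up (maximal, Leray–Hopf,
decaying datum; ANY rate), for every level `Λ`, every clock `g` with a primitive `G`, `|G| ≤ B` on a final
window `(T₀,T)`, and every `t₁ < T`: at some `t ∈ (t₁,T)` some global speed peak `x` with `|u| > Λ` has
BOTH `ν|Du|²_F + g(t)|u| < −⟪u,∇p⟫` and `g(t)|u| < ⟪u,∂ₜu⟫`.  PROVED (`integralPeakFloor_holds`). -/
def IntegralPeakFloor : Prop :=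
  ∀ (ν T : ℝ), 0 < ν → 0 < T →
    ∀ (u : ℝ → E3 → E3) (p : ℝ → E3 → ℝ),
    IsMaximalSmoothSolution ν 0 u p T → IsLerayHopfOn T ν 0 (u 0) u → HasRapidSpatialDecay (u 0) →
    ∀ (Λ B T₀ : ℝ) (G g : ℝ → ℝ) (t₁ : ℝ), T₀ < T → (∀ t ∈ Ioo T₀ T, HasDerivAt G (g t) t) →
      (∀ t ∈ Ioo T₀ T, |G t| ≤ B) → t₁ < T →
      ∃ t ∈ Ioo t₁ T, ∃ x, IsSpeedPeak u t x ∧ Λ < ‖u t x‖ ∧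
        ν * frobeniusNormSq (fderiv ℝ (u t) x) + g t * ‖u t x‖ < -⟪u t x, gradient (p t) x⟫ ∧
        g t * ‖u t x‖ < ⟪u t x, timeDerivWithin (Ico 0 T) u t x⟫

/-- The DOOR LEVEL `A + (G(t ∨ s₁) − G(s₁)) + (t ∨ s₁ − s₁)`: `≡ A` up to `s₁`, then rising with slope
`g + 1`. -/
def doorLevel (A s₁ : ℝ) (G : ℝ → ℝ) (t : ℝ) : ℝ := A + (G (max t s₁) - G s₁) + (max t s₁ - s₁)

/-- Before `s₁` the door level is the constant `A`. -/
theorem doorLevel_of_le {A s₁ t : ℝ} {G : ℝ → ℝ} (h : t ≤ s₁) : doorLevel A s₁ G t = A := by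
  simp [doorLevel, max_eq_right h]

/-- Past `s₁` the door level is `A + (G t − G s₁) + (t − s₁)`. -/
theorem doorLevel_of_ge {A s₁ t : ℝ} {G : ℝ → ℝ} (h : s₁ ≤ t) :
    doorLevel A s₁ G t = A + (G t - G s₁) + (t - s₁) := by
  simp [doorLevel, max_eq_left h]

/-- One-sided derivative of the door level past `s₁`. [folklore] -/
theorem hasDerivWithinAt_doorLevel {A s₁ t₀ : ℝ} {G g : ℝ → ℝ} (h₁ : s₁ < t₀)
    (hG : HasDerivAt G (g t₀) t₀) :
    HasDerivWithinAt (doorLevel A s₁ G) (g t₀ + 1) (Iic t₀) t₀ := by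
  have h1 : HasDerivAt (fun t => A + (G t - G s₁) + (t - s₁)) (g t₀ + 1) t₀ :=
    (((hasDerivAt_const t₀ A).add (hG.sub_const (G s₁))).add
      ((hasDerivAt_id' t₀).sub_const s₁)).congr_deriv (by ring)
  have h2 : doorLevel A s₁ G =ᶠ[𝓝 t₀] fun t => A + (G t - G s₁) + (t - s₁) := by
    filter_upwards [Ioi_mem_nhds h₁] with t ht
    exact doorLevel_of_ge (le_of_lt ht)
  exact (h1.congr_of_eventuallyEq h2).hasDerivWithinAt

/-- Continuity of the door level on `[0,t₂]` when `G` is differentiable on `(T₀,T) ⊇ [s₁,t₂]`. [folklore] -/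
theorem continuousOn_doorLevel {A s₁ t₂ T₀ T' : ℝ} {G g : ℝ → ℝ} (hT₀ : T₀ < s₁) (ht₂ : t₂ < T')
    (hs : s₁ ≤ t₂) (hG : ∀ t ∈ Ioo T₀ T', HasDerivAt G (g t) t) :
    ContinuousOn (doorLevel A s₁ G) (Icc 0 t₂) := by
  have hGc : ContinuousOn G (Ioo T₀ T') := fun t ht => (hG t ht).continuousAt.continuousWithinAt
  have hm : Continuous fun t : ℝ => max t s₁ := continuous_id.max continuous_const
  have hmaps : MapsTo (fun t : ℝ => max t s₁) (Icc 0 t₂) (Ioo T₀ T') := fun t ht =>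
    ⟨hT₀.trans_le (le_max_right _ _), (max_le ht.2 hs).trans_lt ht₂⟩
  have h1 : ContinuousOn (fun t => G (max t s₁)) (Icc 0 t₂) := hGc.comp hm.continuousOn hmaps
  show ContinuousOn (fun t => A + (G (max t s₁) - G s₁) + (max t s₁ - s₁)) (Icc 0 t₂)
  exact (continuousOn_const.add (h1.sub continuousOn_const)).add
    (hm.continuousOn.sub continuousOn_const)

/-- The door level with `A = K + 2B` stays `≥ K` on `[0,T)`. [folklore] -/
theorem le_doorLevel {K B s₁ T₀ T' t : ℝ} {G : ℝ → ℝ} (hs₁ : T₀ < s₁) (hs₁T : s₁ < T') (ht : t < T')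
    (hGB : ∀ t ∈ Ioo T₀ T', |G t| ≤ B) : K ≤ doorLevel (K + 2 * B) s₁ G t := by
  obtain ⟨h1a, -⟩ := abs_le.1 (hGB (max t s₁) ⟨hs₁.trans_le (le_max_right _ _), max_lt ht hs₁T⟩)
  obtain ⟨-, h2b⟩ := abs_le.1 (hGB s₁ ⟨hs₁, hs₁T⟩)
  have h3 : s₁ ≤ max t s₁ := le_max_right _ _
  unfold doorLevel
  linarith

/-- **Core of §6: row F1a ⇒ the integral peak floor.**  With `K >` the speed on `[0,s₁]` and `> Λ`,
the door level `doorLevel (K+2B) s₁ G` is bounded by `B' = K + 4B + T` on `[0,T)`; F1a's contrapositive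
with `C = 1` puts the speed above `√ν/√(T−t₂) > B'` at some `t₂` near `T`; the first crossing
(`exists_peak_hit_level`, slope `g + 1`) is a fast speed peak where both inequalities hold strictly.
[folklore] -/
theorem integralPeakFloor_of_rowF1a (hF1a : ScenarioCensus.Row_F1a) : IntegralPeakFloor := by
  intro ν T hν hT u p hmx hLH hdec Λ B T₀ G g t₁ hT₀T hGd hGB ht₁T
  have hsol : IsClassicalNSSolutionOn (Ico 0 T) ν 0 u p := hmx.1
  -- an interior starting time `s₁ > max(t₁, T₀, 0)`
  set m : ℝ := max (max t₁ T₀) 0 with hmdef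
  have hmT : m < T := max_lt (max_lt ht₁T hT₀T) hT
  have hm0 : 0 ≤ m := le_max_right _ _
  set s₁ : ℝ := (m + T) / 2 with hs₁def
  have hs₁0 : 0 < s₁ := by rw [hs₁def]; linarith
  have hs₁T : s₁ < T := by rw [hs₁def]; linarith
  have hms₁ : m < s₁ := by rw [hs₁def]; linarith
  have ht₁s₁ : t₁ < s₁ := lt_of_le_of_lt ((le_max_left _ _).trans (le_max_left _ _)) hms₁
  have hT₀s₁ : T₀ < s₁ := lt_of_le_of_lt ((le_max_right _ _).trans (le_max_left _ _)) hms₁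
  -- `K` above the speed on `[0, s₁]` and above `Λ`
  obtain ⟨q, hsolq, hH, -, -⟩ := RungReynoldsOne.stub_taoCover hν hT hsol hLH hdec ⟨hs₁0, hs₁T⟩
  obtain ⟨M, hM0, hM⟩ := exists_forall_norm_le_of_hasBoundedSobolevNormsOn hsolq hH
  set K : ℝ := M + max Λ 0 + 1 with hKdef
  have hK0 : 0 < K := by
    have : 0 ≤ max Λ 0 := le_max_right _ _
    rw [hKdef]; linarith
  have hKΛ : Λ < K := by
    have : Λ ≤ max Λ 0 := le_max_left _ _
    rw [hKdef]; linarith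
  have hB0 : 0 ≤ B := (abs_nonneg _).trans (hGB s₁ ⟨hT₀s₁, hs₁T⟩)
  -- the door level is bounded by `B'` on `[0,T)`
  set B' : ℝ := K + 4 * B + T with hB'def
  have hB'0 : 0 < B' := by rw [hB'def]; linarith
  have hLle : ∀ t, t < T → doorLevel (K + 2 * B) s₁ G t ≤ B' := fun t htT => by
    obtain ⟨-, h1b⟩ :=
      abs_le.1 (hGB (max t s₁) ⟨hT₀s₁.trans_le (le_max_right _ _), max_lt htT hs₁T⟩)
    obtain ⟨h2a, -⟩ := abs_le.1 (hGB s₁ ⟨hT₀s₁, hs₁T⟩)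
    have h3 : max t s₁ < T := max_lt htT hs₁T
    rw [hB'def]; unfold doorLevel; linarith
  -- F1a, contrapositively, with `C = 1`: the speed is frequently above `√ν/√(T−t)`
  have hκ : (9 + 2 * Real.sqrt 15) / 42 * 1 < 1 := by
    have h15 : Real.sqrt 15 < 4 := by
      rw [Real.sqrt_lt' (by norm_num : (0:ℝ) < 4)]; norm_num
    linarith
  have hnot : ¬ (∀ᶠ t in 𝓝[<] T, ∀ x, Real.sqrt (T - t) * ‖u t x‖ ≤ 1 * Real.sqrt ν) :=
    fun h => hmx.2 (hF1a ν T 1 hν hT one_pos hκ u p hsol hLH hdec h)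
  have hfreq : ∃ᶠ t in 𝓝[<] T, ∃ x, Real.sqrt ν < Real.sqrt (T - t) * ‖u t x‖ :=
    (Filter.not_eventually.1 hnot).mono fun t ht => by
      push Not at ht
      simpa using ht
  -- the crossing time `t₂`
  have hsν : 0 < Real.sqrt ν := Real.sqrt_pos.2 hν
  set ρ : ℝ := (Real.sqrt ν / B') ^ 2 with hρdef
  have hρ : 0 < ρ := by rw [hρdef]; positivity
  set s₂ : ℝ := max s₁ (T - ρ) with hs₂def
  have hs₂T : s₂ < T := max_lt hs₁T (by linarith)
  obtain ⟨t₂, ⟨x₂, hx₂⟩, ht₂⟩ := (hfreq.and_eventually (Ioo_mem_nhdsLT hs₂T)).exists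
  have hs₁t₂ : s₁ < t₂ := lt_of_le_of_lt (le_max_left _ _) ht₂.1
  have ht₂T : t₂ < T := ht₂.2
  have hTt : 0 < T - t₂ := sub_pos.2 ht₂T
  have hsq : 0 < Real.sqrt (T - t₂) := Real.sqrt_pos.2 hTt
  have hreach : ∃ x, doorLevel (K + 2 * B) s₁ G t₂ ≤ ‖u t₂ x‖ := by
    refine ⟨x₂, (hLle t₂ ht₂T).trans ?_⟩
    have h4 : Real.sqrt (T - t₂) < Real.sqrt ν / B' := by
      have hTtρ : T - t₂ < ρ := by
        have : T - ρ < t₂ := lt_of_le_of_lt (le_max_right _ _) ht₂.1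
        linarith
      have hnn : 0 ≤ Real.sqrt ν / B' := by positivity
      calc Real.sqrt (T - t₂) < Real.sqrt ρ := Real.sqrt_lt_sqrt hTt.le hTtρ
        _ = Real.sqrt ν / B' := by rw [hρdef, Real.sqrt_sq hnn]
    have h5 : B' * Real.sqrt (T - t₂) < Real.sqrt ν := by
      have := mul_lt_mul_of_pos_left h4 hB'0
      have e : B' * (Real.sqrt ν / B') = Real.sqrt ν := by field_simp
      linarith [e ▸ this]
    have h6 : B' * Real.sqrt (T - t₂) < ‖u t₂ x₂‖ * Real.sqrt (T - t₂) := by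
      rw [mul_comm (‖u t₂ x₂‖)]; exact h5.trans hx₂
    exact (lt_of_mul_lt_mul_right h6 hsq.le).le
  -- the first crossing of the door level
  have hLc : ContinuousOn (doorLevel (K + 2 * B) s₁ G) (Icc 0 t₂) :=
    continuousOn_doorLevel hT₀s₁ ht₂T hs₁t₂.le hGd
  have hKL : ∀ t ∈ Icc 0 t₂, K ≤ doorLevel (K + 2 * B) s₁ G t := fun t ht =>
    le_doorLevel hT₀s₁ hs₁T (ht.2.trans_lt ht₂T) hGB
  have hLd : ∀ t ∈ Ioc s₁ t₂,
      HasDerivWithinAt (doorLevel (K + 2 * B) s₁ G) (g t + 1) (Iic t) t := fun t ht =>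
    hasDerivWithinAt_doorLevel ht.1 (hGd t ⟨hT₀s₁.trans ht.1, ht.2.trans_lt ht₂T⟩)
  have hbefore : ∀ t ∈ Icc 0 s₁, ∀ x, ‖u t x‖ < doorLevel (K + 2 * B) s₁ G t := fun t ht x => by
    rw [doorLevel_of_le ht.2]
    have := hM t ht x
    have : 0 ≤ max Λ 0 := le_max_right _ _
    rw [hKdef]; linarith
  obtain ⟨t₀, ht₀, x₀, hpeak, heq, hpush, hgain⟩ :=
    exists_peak_hit_level (L' := fun t => g t + 1) hν hT hsol hLH hdec hK0 hs₁0 hs₁t₂ ht₂T hLc hKL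
      hLd hbefore hreach
  have ht₀T : t₀ < T := ht₀.2.trans_lt ht₂T
  have hKle : K ≤ ‖u t₀ x₀‖ := heq ▸ hKL t₀ ⟨(hs₁0.trans ht₀.1).le, ht₀.2⟩
  have hupos : 0 < ‖u t₀ x₀‖ := hK0.trans_le hKle
  have e : ‖u t₀ x₀‖ * (g t₀ + 1) = g t₀ * ‖u t₀ x₀‖ + ‖u t₀ x₀‖ := by ring
  rw [e] at hpush hgain
  refine ⟨t₀, ⟨ht₁s₁.trans ht₀.1, ht₀T⟩, x₀, hpeak, hKΛ.trans_le hKle, ?_, ?_⟩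
  · linarith
  · linarith

/-- **The integral peak floor (kernel).** [folklore] -/
theorem integralPeakFloor_holds : IntegralPeakFloor :=
  integralPeakFloor_of_rowF1a ScenarioCensus.row_F1a_excluded

/-- **Row I-peak from the integral floor** (contrapositive reading). [folklore] -/
theorem rowIpeak_of_integralPeakFloor (h : IntegralPeakFloor) : Row_Ipeak := by
  intro ν T hν hT u p hsol hLH hdec hI
  obtain ⟨Λ, B, T₀, G, g, hT₀T, hGd, hGB, hev⟩ := hI
  obtain ⟨T₁, hT₁T, hT₁⟩ := mem_nhdsLT_iff_exists_Ioo_subset.1 hev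
  by_contra hext
  obtain ⟨t, ht, x, hpk, hΛ, hpush, -⟩ :=
    h ν T hν hT u p ⟨hsol, hext⟩ hLH hdec Λ B T₀ G g T₁ hT₀T hGd hGB hT₁T
  have := hT₁ ht x hpk hΛ
  linarith

/-- **Row IG-peak from the integral floor** (contrapositive reading). [folklore] -/
theorem rowIGpeak_of_integralPeakFloor (h : IntegralPeakFloor) : Row_IGpeak := by
  intro ν T hν hT u p hsol hLH hdec hI
  obtain ⟨Λ, B, T₀, G, g, hT₀T, hGd, hGB, hev⟩ := hI
  obtain ⟨T₁, hT₁T, hT₁⟩ := mem_nhdsLT_iff_exists_Ioo_subset.1 hev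
  by_contra hext
  obtain ⟨t, ht, x, hpk, hΛ, -, hgain⟩ :=
    h ν T hν hT u p ⟨hsol, hext⟩ hLH hdec Λ B T₀ G g T₁ hT₀T hGd hGB hT₁T
  have := hT₁ ht x hpk hΛ
  linarith

/-- **Row I-peak EXCLUDED (kernel).** [folklore] -/
theorem rowIpeak_holds : Row_Ipeak := rowIpeak_of_integralPeakFloor integralPeakFloor_holds

/-- **Row IG-peak EXCLUDED (kernel).** [folklore] -/
theorem rowIGpeak_holds : Row_IGpeak := rowIGpeak_of_integralPeakFloor integralPeakFloor_holds

/-- **No doubly supercritical peaks, modulus `δ`**: at every fast speed peak near `T` the pressure push OR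
the speed gain is `δ`-subcritical for the blow-up clock. [folklore] -/
def HasNoDoublySupercriticalPeak (ν T δ : ℝ) (u : ℝ → E3 → E3) (p : ℝ → E3 → ℝ) : Prop :=
  ∃ Λ : ℝ, ∀ᶠ t in 𝓝[<] T, ∀ x, IsSpeedPeak u t x → Λ < ‖u t x‖ →
    -⟪u t x, gradient (p t) x⟫ ≤ ν * frobeniusNormSq (fderiv ℝ (u t) x) +
        δ * Real.sqrt ν / ((T - t) * Real.sqrt (T - t)) * ‖u t x‖ ∨
      ⟪u t x, timeDerivWithin (Ico 0 T) u t x⟫ ≤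
        δ * Real.sqrt ν / ((T - t) * Real.sqrt (T - t)) * ‖u t x‖

/-- **Row PG-peak** (the joint row; no rate · no symmetry · Clay class): no doubly supercritical peaks
with modulus `0 ≤ δ < 9 − 2√15` ⇒ smooth extension past `T`.  Contains P-peak and G-peak.  PROVED
(`rowPGpeak_holds`). -/
def Row_PGpeak : Prop :=
  ∀ (ν T δ : ℝ), 0 < ν → 0 < T → 0 ≤ δ → δ < 9 - 2 * Real.sqrt 15 →
    ∀ (u : ℝ → E3 → E3) (p : ℝ → E3 → ℝ),
    IsClassicalNSSolutionOn (Ico 0 T) ν 0 u p → IsLerayHopfOn T ν 0 (u 0) u →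
    HasRapidSpatialDecay (u 0) → HasNoDoublySupercriticalPeak ν T δ u p →
    HasSmoothExtensionPast ν 0 u T

/-- **Row PG-peak from the peak-push floor** (its exact contrapositive reading). [folklore] -/
theorem rowPGpeak_of_peakPushFloor (h : PeakPushFloor) : Row_PGpeak := by
  intro ν T δ hν hT hδ hδlt u p hsol hLH hdec hPG
  obtain ⟨Λ, hev⟩ := hPG
  obtain ⟨T₀, hT₀T, hT₀⟩ := mem_nhdsLT_iff_exists_Ioo_subset.1 hev
  by_contra hext
  obtain ⟨t, ht, x, hpk, hΛ, hpush, hgain⟩ :=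
    h ν T hν hT u p ⟨hsol, hext⟩ hLH hdec δ Λ T₀ hδ hδlt hT₀T
  rcases hT₀ ht x hpk hΛ with h1 | h1 <;> linarith

/-- **Row PG-peak EXCLUDED (kernel).** [folklore] -/
theorem rowPGpeak_holds : Row_PGpeak := rowPGpeak_of_peakPushFloor peakPushFloor_holds

/-- Subcritically pushed peaks are not doubly supercritical. -/
theorem hasNoDoublySupercriticalPeak_of_push {δ : ℝ} (h : HasSubcriticalPeakPush ν T δ u p) :
    HasNoDoublySupercriticalPeak ν T δ u p := by
  obtain ⟨Λ, hev⟩ := h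
  exact ⟨Λ, hev.mono fun t ht x hpk hΛ => Or.inl (ht x hpk hΛ)⟩

/-- Peaks with subcritical gain are not doubly supercritical. -/
theorem hasNoDoublySupercriticalPeak_of_gain {δ : ℝ} (h : HasSubcriticalPeakGain ν T δ u) :
    HasNoDoublySupercriticalPeak ν T δ u p := by
  obtain ⟨Λ, hev⟩ := h
  exact ⟨Λ, hev.mono fun t ht x hpk hΛ => Or.inr (ht x hpk hΛ)⟩

/-- **Lattice edge PG-peak ⊇ P-peak.** [folklore] -/
theorem rowPpeak_of_rowPGpeak (h : Row_PGpeak) : Row_Ppeak :=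
  fun ν T δ hν hT hδ hδlt u p hsol hLH hdec hP =>
    h ν T δ hν hT hδ hδlt u p hsol hLH hdec (hasNoDoublySupercriticalPeak_of_push hP)

/-- **Lattice edge PG-peak ⊇ G-peak.** [folklore] -/
theorem rowGpeak_of_rowPGpeak (h : Row_PGpeak) : Row_Gpeak :=
  fun ν T δ hν hT hδ hδlt u p hsol hLH hdec hG =>
    h ν T δ hν hT hδ hδlt u p hsol hLH hdec (hasNoDoublySupercriticalPeak_of_gain hG)



end Summit.NavierStokesRegularity.NavierStokesRegularity.Theorems.ScenarioCensus.PeakPush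

end
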